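import Summits.QuantumFields.BalabanUV.Beta.FP.KernelStepDressingHessKer
import Summits.QuantumFields.BalabanUV.Beta.CombHId2CopySum

/-!
# `BalabanUV.Beta.FP.KernelStepDressingPeriodised` — road «FP», binder row D1, ROUTE T (β1), (H5-F box) junctions, THE ROAD's ANALYTIC PIECE (i):
# **THE DIAGONAL PERIODISATION PASSES THROUGH THE STEP DRESSING** — `perF M (dper M (dressV N L w V μ y)) p q = Σ_c Σ'_t w c μ (L•y − t) · perF M (dper M (V c t)) p q`

WHY (located).  The END at the record (skeleton v10-O, 37) displays four F-letters `hHF₁ hQF₁ hHF₂ hQF₂` — the door's displayed fine jets `H₁f ∕ Q₁₁f ∕ H′₂f ∕ Q₁₂f` at the source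
`dv (μ, y)` EQUAL the periodised dressed F-families (road g58 INBOX item (4); g59 `V11-DELTA.md`; an2 g81 W-4: (C1) class, scoping note first).  The road's scoping (SPEC-64 §19 (3),
HANDOFF g59): each junction factors as (i) periodisation through the dressing superposition (analytic, road), (ii) v10's own N-side identification one storey down on the finer
box (`hHN₁ …` by `TowerN1RowsFamily`), (iii) the door data's ONE-STOREY RECURSION (`H₁f n B (dv (μ,y)) = Lc⁴·Σ_{c,t} wStep Lc (n+1) c μ (Lc•y − t) • H′₁f (n−1) B⁺ (dv (c,t))`-type —
the (C1) identity proper, the row's).  THIS FILE types (i) for the first-order family: `dper M` of the absolutely convergent superposition `dressV` is the superposition of the `dper M`'s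
(`CombHId2CopySum.dper_tsum_family` — Fubini on a product majorant — once every member is re-centred at the dressed family's own point `N•(L•y)` with a summable constant: the column
weight's decay pays for the re-centring when the members' rate is weakened to `min δ (δw ∕ 4N)`).

WHAT ([folklore] lattice-sum bookkeeping; generic dimension `d`; no `def`, no `def … : Prop`, nothing cited, 0 sorry).
* §0 two-centre copies of `CombHId2CopySum`'s family lemmas (`biLoc_tsum_family₂`, `prodBound_dper_family₂`, **`dper_tsum_family₂`**) — the engine the SECOND-order dressing
  twin needs (its members `W c t e t′` live at two points); unused by §1–§2, typed here so the successor's `dressW` file is plumbing only.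
* §1 `abs_dressVTerm_le` — `|w c μ (L•y − t) · V c t x z a b| ≤ (Cw·Cv·e^{−(δw∕2)|t − L•y|₁}) · e^{−m(|x − N•L•y|₁ + |z − N•L•y|₁)}`, `m = min δ (δw∕(4N))`; `summable_dressVWeight`.
* §2 **`dper_cwsumV_apply`**, **`dper_dressV_apply`** — the interchange, per column index `c` and summed; **`perZ_dper_dressV_apply`**, **`perF_dper_dressV`** — the second
  (torus) periodisation passes through as well (`decays_dper_diag` + `tsum_comm_of_prodBound` + `HasSum.prod_fiberwise`).
WHAT THIS IS NOT: not the second-order twin (`dressW`, the wound even half) — same argument twice, next file; not (ii)(iii); not a junction; nothing of Bałaban's asserted, valued or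
discharged; 0 estimates beyond [folklore] geometric series BY NAME; 0∕4 row-D1 binders; NOT (C1), NOT (T-ID), NOT D1, NEVER «G-an2-4 closed», NOT BetaPertH, NOT continuum, NOT Clay.
HONEST DEPENDENCY (page 1, mandatory): continuum YM on T⁴ ⇐ BetaPertH ∧ nine spine estimates (0/9 proved); BetaPertH ⇐ (D1) ∧ (D4) ∧ CAP+tail;
G-an2-4 gates asym, D1 and NE2/3/4.  HONEST FRAMING (cell contract, verbatim): «discharging `BetaPertH` makes Bałaban's UV stability UNCONDITIONAL —
a real constructive-QFT result; it is NOT the continuum limit and NOT the Clay problem.»  ABSOLUTE RULE (cell charter, verbatim): «No internally-minted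
statement may enter as a cited fact. Every hypothesis is either kernel-proved in this package or a verbatim quotation of a PUBLISHED theorem with page
reference. The manuscript(s) under audit are NOT citable for their own disputed steps — they are the thing under adjudication; programme-internal
(2001/route/tribunal) claims are never citable.»  Road «FP» OWNER, b2b-balaban-beta-d1-p3 gen 59, 2026-08-29.  No existing file touched.
-/

noncomputable section

open scoped BigOperators

namespace Summit.QuantumFields.BalabanUV.Beta.FP.KernelStepDressingPeriodised

open Finset
open Literature.MathematicalPhysics.QuantumFieldTheory
open Literature.MathematicalPhysics.QuantumFieldTheory.Balaban1983to89
open Literature.MathematicalPhysics.QuantumFieldTheory.Balaban1983to89.Beta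
open B12Sec2to5 (l1 l1_nonneg)
open B4TorusKernel.MultiPeriod (translate)
open ExpKernelCalculus (Site MKer BiLoc VertexFamily l1_natSmul l1_sub_triangle summable_exp_shift')
open DressedMomentNormalisation (EKer)
open OneStepResolventKernel (Fib)
open InterLevelTransport (cwsum cwsum_apply)
open Summit.QuantumFields.BalabanUV.Beta.FP.KernelPeriodisationFib (Idx perF perF_apply)
open Summit.QuantumFields.BalabanUV.Beta.FP.KernelPeriodisationFibLoc (dper dper_apply)
open ExpKernelCalculus (l1_sub_symm)
open KernelWard (ProdBound tsum_comm_of_prodBound)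
open Summit.QuantumFields.BalabanUV.Beta.CombHId2CopySum (dper_tsum_family summable_dper_family)
open Summit.QuantumFields.BalabanUV.Beta.FP.KernelStepDressing (dressV dressV_apply)
open Summit.QuantumFields.BalabanUV.Beta.FP.KernelStepDressingHessKer (dressV_eq_sum abs_col_le)

variable {d : ℕ} {N : ℕ} [NeZero N] (L : ℕ) {w : EKer (d + 1)} {Cw δw : ℝ}
  {V : Fin (d + 1) → Site (d + 1) → MKer (d + 1) (Fib d)} {Cv δ : ℝ}

/-! ## §0 Two-centre copies of `CombHId2CopySum`'s family lemmas (the second-order dressing twin's members live at TWO points `(p, q)`) -/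

section TwoCentre

variable (M : Fin (d + 1) → ℕ) [∀ μ, NeZero (M μ)]
  {T : Site (d + 1) → MKer (d + 1) (Fib d)} {p q : Site (d + 1)} {g : Site (d + 1) → ℝ} {δ' : ℝ}

omit [NeZero N] [∀ μ, NeZero (M μ)] in
/-- [folklore] a family bounded by `g n · e^{−δ(|x−p|₁+|z−q|₁)}` with `g` summable sums to a kernel bi-localised at `(p, q)` (two-centre copy of `CombHId2CopySum.biLoc_tsum_family`). -/
theorem biLoc_tsum_family₂ (hT : ∀ n x z a b, |T n x z a b| ≤ g n * Real.exp (-δ' * (l1 (x - p) + l1 (z - q)))) (hg : Summable g) :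
    BiLoc (fun x z a b => ∑' n, T n x z a b) p q (∑' n, g n) δ' := by
  intro x z a b
  have h := tsum_of_norm_bounded (hg.mul_right (Real.exp (-δ' * (l1 (x - p) + l1 (z - q))))).hasSum
    fun n => by rw [Real.norm_eq_abs]; exact hT n x z a b
  rw [Real.norm_eq_abs, tsum_mul_right] at h
  exact h

omit [NeZero N] in
/-- [folklore] the period-translates × copies double family has a product majorant also for TWO localisation points (copy of `CombHId2CopySum.prodBound_dper_family`; only the
first point's decay is spent on the copy sum). -/
theorem prodBound_dper_family₂ (hT : ∀ n x z a b, |T n x z a b| ≤ g n * Real.exp (-δ' * (l1 (x - p) + l1 (z - q)))) (hg : Summable g)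
    (hg0 : ∀ n, 0 ≤ g n) (hδ' : 0 < δ') (x z : Site (d + 1)) (a b : Fib d) :
    ProdBound fun m n => T n (translate M x m) (translate M z m) a b := by
  refine ⟨fun m => Real.exp (-δ' * l1 (translate M x m - p)), g, (KernelPeriodisationFibLoc.summable_exp_l1_translate M hδ' p x).1, hg,
    fun m => (Real.exp_pos _).le, hg0, fun m n => ?_⟩
  refine (hT n _ _ a b).trans ?_
  rw [mul_add, Real.exp_add, mul_comm (g n)]
  have h1 : Real.exp (-δ' * l1 (translate M z m - q)) ≤ 1 := by
    rw [Real.exp_le_one_iff]; exact mul_nonpos_of_nonpos_of_nonneg (neg_nonpos.2 hδ'.le) (l1_nonneg _)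
  calc Real.exp (-δ' * l1 (translate M x m - p)) * Real.exp (-δ' * l1 (translate M z m - q)) * g n
      ≤ Real.exp (-δ' * l1 (translate M x m - p)) * 1 * g n :=
        mul_le_mul_of_nonneg_right (mul_le_mul_of_nonneg_left h1 (Real.exp_pos _).le) (hg0 n)
    _ = Real.exp (-δ' * l1 (translate M x m - p)) * g n := by rw [mul_one]

omit [NeZero N] in
/-- [folklore] **`dper` PASSES THROUGH A TWO-CENTRE COPY SUM**: `dper M (x z ↦ Σ'_n T n x z) x z a b = Σ'_n dper M (T n) x z a b`. -/
theorem dper_tsum_family₂ (hT : ∀ n x z a b, |T n x z a b| ≤ g n * Real.exp (-δ' * (l1 (x - p) + l1 (z - q)))) (hg : Summable g)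
    (hg0 : ∀ n, 0 ≤ g n) (hδ' : 0 < δ') (x z : Site (d + 1)) (a b : Fib d) :
    dper M (fun x z a b => ∑' n, T n x z a b) x z a b = ∑' n, dper M (T n) x z a b := by
  simp only [dper_apply]
  exact tsum_comm_of_prodBound (prodBound_dper_family₂ M hT hg hg0 hδ' x z a b)

end TwoCentre

/-! ## §1 Every dressing term re-centred at the dressed family's point, with a summable constant -/

/-- [folklore] **`abs_dressVTerm_le` — THE TERMWISE COMMON-CENTRE BOUND**: a column entry decaying from `0` at rate `δw`, read at `L•y − t`, times a member bi-localised at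
`(N•t, N•t)` (rate `δ`), is bounded by `(Cw·Cv·e^{−(δw∕2)|t − L•y|₁}) · e^{−m(|x − N•(L•y)|₁ + |z − N•(L•y)|₁)}` with `m = min δ (δw ∕ (4N))` (triangle inequality through `N•t`;
`|N•t − N•(L•y)|₁ = N·|t − L•y|₁` absorbs into the weight's spare half). -/
theorem abs_dressVTerm_le (hw : ∀ c a u, |w c a u| ≤ Cw * Real.exp (-δw * l1 u)) (hCw : 0 ≤ Cw) (hδw : 0 < δw)
    (hV : VertexFamily V N Cv δ) (hδ : 0 < δ) (c μ : Fin (d + 1)) (y t x z : Site (d + 1)) (a b : Fib d) :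
    |w c μ ((L : ℤ) • y - t) * V c t x z a b|
      ≤ (Cw * Cv * Real.exp (-(δw / 2) * l1 (t - (L : ℤ) • y)))
          * Real.exp (-(min δ (δw / (4 * N))) * (l1 (x - (N : ℤ) • ((L : ℤ) • y)) + l1 (z - (N : ℤ) • ((L : ℤ) • y)))) := by
  have hCv : 0 ≤ Cv := (hV c t).nonneg a
  have hNpos : (0 : ℝ) < N := by exact_mod_cast Nat.pos_of_ne_zero (NeZero.ne N)
  have h1 : |w c μ ((L : ℤ) • y - t)| ≤ Cw * Real.exp (-δw * l1 (t - (L : ℤ) • y)) := abs_col_le hw c μ _ t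
  have h2 : |V c t x z a b| ≤ Cv * Real.exp (-δ * (l1 (x - (N : ℤ) • t) + l1 (z - (N : ℤ) • t))) := (hV c t) x z a b
  set A := l1 (t - (L : ℤ) • y) with hA
  set B := l1 (x - (N : ℤ) • t) with hB
  set C := l1 (z - (N : ℤ) • t) with hC
  set B' := l1 (x - (N : ℤ) • ((L : ℤ) • y)) with hB'
  set C' := l1 (z - (N : ℤ) • ((L : ℤ) • y)) with hC'
  set m := min δ (δw / (4 * N)) with hm
  have hNA : l1 ((N : ℤ) • t - (N : ℤ) • ((L : ℤ) • y)) = N * A := by rw [← smul_sub, l1_natSmul]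
  have hB'le : B' ≤ B + N * A := by
    have h := l1_sub_triangle x ((N : ℤ) • t) ((N : ℤ) • ((L : ℤ) • y)); rwa [hNA] at h
  have hC'le : C' ≤ C + N * A := by
    have h := l1_sub_triangle z ((N : ℤ) • t) ((N : ℤ) • ((L : ℤ) • y)); rwa [hNA] at h
  have hA0 : 0 ≤ A := l1_nonneg _
  have hB0 : 0 ≤ B := l1_nonneg _
  have hC0 : 0 ≤ C := l1_nonneg _
  have hm0 : 0 ≤ m := le_min hδ.le (by positivity)
  have hmδ : m ≤ δ := min_le_left _ _
  have hmN : m * N ≤ δw / 4 := by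
    have h := min_le_right δ (δw / (4 * N))
    rw [← hm] at h
    have := mul_le_mul_of_nonneg_right h hNpos.le
    calc m * N ≤ δw / (4 * N) * N := this
      _ = δw / 4 := by field_simp
  have key : -δw * A + -δ * (B + C) ≤ -(δw / 2) * A + -m * (B' + C') := by
    have hmBC : m * (B' + C') ≤ m * (B + C) + 2 * (m * N) * A := by nlinarith
    nlinarith
  calc |w c μ ((L : ℤ) • y - t) * V c t x z a b| = |w c μ ((L : ℤ) • y - t)| * |V c t x z a b| := abs_mul _ _
    _ ≤ (Cw * Real.exp (-δw * A)) * (Cv * Real.exp (-δ * (B + C))) := mul_le_mul h1 h2 (abs_nonneg _) ((abs_nonneg _).trans h1)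
    _ = Cw * Cv * Real.exp (-δw * A + -δ * (B + C)) := by rw [Real.exp_add]; ring
    _ ≤ Cw * Cv * Real.exp (-(δw / 2) * A + -m * (B' + C')) := mul_le_mul_of_nonneg_left (Real.exp_le_exp.2 key) (mul_nonneg hCw hCv)
    _ = (Cw * Cv * Real.exp (-(δw / 2) * A)) * Real.exp (-m * (B' + C')) := by rw [Real.exp_add]; ring

/-- [folklore] the re-centred constants `t ↦ Cw·Cv·e^{−(δw∕2)|t − L•y|₁}` are summable. -/
theorem summable_dressVWeight (hδw : 0 < δw) (Cw Cv : ℝ) (y : Site (d + 1)) :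
    Summable fun t : Site (d + 1) => Cw * Cv * Real.exp (-(δw / 2) * l1 (t - (L : ℤ) • y)) :=
  (summable_exp_shift' (half_pos hδw) ((L : ℤ) • y)).mul_left (Cw * Cv)

/-! ## §2 The periodisation through the superposition -/

section Per

variable (M : Fin (d + 1) → ℕ) [∀ i, NeZero (M i)]

/-- [folklore] **`dper_cwsumV_apply` — ONE COLUMN INDEX**: `dper M (cwsum N (w c μ (L•y − ·)) (V c)) x z a b = Σ'_t w c μ (L•y − t) · dper M (V c t) x z a b`
(`CombHId2CopySum.dper_tsum_family` at §1's majorant; the scalar leaves `dper` by `tsum_mul_left`). -/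
theorem dper_cwsumV_apply (hw : ∀ c a u, |w c a u| ≤ Cw * Real.exp (-δw * l1 u)) (hCw : 0 ≤ Cw) (hδw : 0 < δw)
    (hV : VertexFamily V N Cv δ) (hδ : 0 < δ) (c μ : Fin (d + 1)) (y x z : Site (d + 1)) (a b : Fib d) :
    dper M (cwsum N (fun t => w c μ ((L : ℤ) • y - t)) (V c)) x z a b
      = ∑' t : Site (d + 1), w c μ ((L : ℤ) • y - t) * dper M (V c t) x z a b := by
  have hCv : 0 ≤ Cv := (hV c 0).nonneg (Sum.inl 0)
  have hNpos : (0 : ℝ) < N := by exact_mod_cast Nat.pos_of_ne_zero (NeZero.ne N)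
  have hm : 0 < min δ (δw / (4 * N)) := lt_min hδ (by positivity)
  have hform : cwsum N (fun t => w c μ ((L : ℤ) • y - t)) (V c)
      = fun x z a b => ∑' t : Site (d + 1), (fun t : Site (d + 1) => fun x z a b => w c μ ((L : ℤ) • y - t) * V c t x z a b) t x z a b := by
    funext x z a b; rw [cwsum_apply]
  rw [hform, dper_tsum_family M (T := fun t : Site (d + 1) => fun x z a b => w c μ ((L : ℤ) • y - t) * V c t x z a b)
    (fun t x z a b => abs_dressVTerm_le L hw hCw hδw hV hδ c μ y t x z a b) (summable_dressVWeight L hδw Cw Cv y)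
    (fun t => by positivity) hm x z a b]
  refine tsum_congr fun t => ?_
  simp only [dper_apply, ← tsum_mul_left]

/-- [folklore] each column's periodised superposition is summable over the period lattice (needed to move the finite column sum through `Σ'_m`). -/
theorem summable_translate_cwsumV (hw : ∀ c a u, |w c a u| ≤ Cw * Real.exp (-δw * l1 u)) (hCw : 0 ≤ Cw) (hδw : 0 < δw)
    (hV : VertexFamily V N Cv δ) (hδ : 0 < δ) (c μ : Fin (d + 1)) (y x z : Site (d + 1)) (a b : Fib d) :
    Summable fun m : Site (d + 1) => cwsum N (fun t => w c μ ((L : ℤ) • y - t)) (V c) (translate M x m) (translate M z m) a b := by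
  have hCv : 0 ≤ Cv := (hV c 0).nonneg (Sum.inl 0)
  have hNpos : (0 : ℝ) < N := by exact_mod_cast Nat.pos_of_ne_zero (NeZero.ne N)
  have hm : 0 < min δ (δw / (4 * N)) := lt_min hδ (by positivity)
  -- the superposition is bi-localised at the dressed point with the summed constant
  have hbl : BiLoc (cwsum N (fun t => w c μ ((L : ℤ) • y - t)) (V c)) ((N : ℤ) • ((L : ℤ) • y)) ((N : ℤ) • ((L : ℤ) • y))
      (∑' t : Site (d + 1), Cw * Cv * Real.exp (-(δw / 2) * l1 (t - (L : ℤ) • y))) (min δ (δw / (4 * N))) := by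
    have h := CombHId2CopySum.biLoc_tsum_family (T := fun t : Site (d + 1) => fun x z a b => w c μ ((L : ℤ) • y - t) * V c t x z a b)
      (fun t x z a b => abs_dressVTerm_le L hw hCw hδw hV hδ c μ y t x z a b) (summable_dressVWeight L hδw Cw Cv y)
    intro x' z' a' b'
    have h' := h x' z' a' b'
    rw [cwsum_apply]
    exact h'
  have hC : 0 ≤ ∑' t : Site (d + 1), Cw * Cv * Real.exp (-(δw / 2) * l1 (t - (L : ℤ) • y)) := tsum_nonneg fun t => by positivity
  exact KernelPeriodisationFibLoc.summable_dper M hbl hC hm x z a b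

/-- [folklore] **`dper_dressV_apply` — THE DIAGONAL PERIODISATION OF THE DRESSED FIRST-ORDER FAMILY**:
`dper M (dressV N L w V μ y) x z a b = Σ_c Σ'_t w c μ (L•y − t) · dper M (V c t) x z a b`. -/
theorem dper_dressV_apply (hw : ∀ c a u, |w c a u| ≤ Cw * Real.exp (-δw * l1 u)) (hCw : 0 ≤ Cw) (hδw : 0 < δw)
    (hV : VertexFamily V N Cv δ) (hδ : 0 < δ) (μ : Fin (d + 1)) (y x z : Site (d + 1)) (a b : Fib d) :
    dper M (dressV N L w V μ y) x z a b
      = ∑ c : Fin (d + 1), ∑' t : Site (d + 1), w c μ ((L : ℤ) • y - t) * dper M (V c t) x z a b := by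
  rw [dressV_eq_sum, dper_apply]
  simp only [Finset.sum_apply]
  rw [Summable.tsum_finsetSum fun c _ => summable_translate_cwsumV L M hw hCw hδw hV hδ c μ y x z a b]
  refine Finset.sum_congr rfl fun c _ => ?_
  rw [← dper_apply, dper_cwsumV_apply L M hw hCw hδw hV hδ c μ y x z a b]

/-- [folklore] **`perZ_dper_dressV_apply` — THE SECOND PERIODISATION PASSES THROUGH TOO**: `perZ M (dper M (dressV …)) x z a b = Σ_c Σ'_t w c μ (L•y − t) · perZ M (dper M (V c t)) x z a b`
(each re-centred term's `dper` DECAYS with constant `g t · K_{d+1}(m∕2)` — `decays_dper_diag` — so `(m, t) ↦ w · dper M (V c t) x (z + M∘m)` has the product majorant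
`(g t · K) · e^{−(m∕2)|z + M∘m − x|₁}`; `KernelWard.tsum_comm_of_prodBound`, and `HasSum.prod_fiberwise` for the column sum). -/
theorem perZ_dper_dressV_apply (hw : ∀ c a u, |w c a u| ≤ Cw * Real.exp (-δw * l1 u)) (hCw : 0 ≤ Cw) (hδw : 0 < δw)
    (hV : VertexFamily V N Cv δ) (hδ : 0 < δ) (μ : Fin (d + 1)) (y x z : Site (d + 1)) (a b : Fib d) :
    KernelPeriodisationFib.perZ M (dper M (dressV N L w V μ y)) x z a b
      = ∑ c : Fin (d + 1), ∑' t : Site (d + 1), w c μ ((L : ℤ) • y - t) * KernelPeriodisationFib.perZ M (dper M (V c t)) x z a b := by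
  have hCv : 0 ≤ Cv := (hV μ 0).nonneg (Sum.inl 0)
  have hNpos : (0 : ℝ) < N := by exact_mod_cast Nat.pos_of_ne_zero (NeZero.ne N)
  set m' : ℝ := min δ (δw / (4 * N)) with hm'
  have hm : 0 < m' := lt_min hδ (by positivity)
  -- per column index: the (copy, source) family and its product majorant
  have hPB : ∀ c : Fin (d + 1), KernelWard.ProdBound (fun (mm : Site (d + 1)) (t : Site (d + 1)) =>
      w c μ ((L : ℤ) • y - t) * dper M (V c t) x (translate M z mm) a b) := by
    intro c
    refine ⟨fun mm => Real.exp (-(m' / 2) * l1 (translate M z mm - x)),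
      fun t => Cw * Cv * Real.exp (-(δw / 2) * l1 (t - (L : ℤ) • y)) * B4Sect5Proof.latticeConst (d + 1) (m' / 2),
      (KernelPeriodisationFibLoc.summable_exp_l1_translate M (half_pos hm) x z).1,
      (summable_dressVWeight L hδw Cw Cv y).mul_right _, fun mm => (Real.exp_pos _).le,
      fun t => mul_nonneg (by positivity) (B4Sect5Proof.latticeConst_nonneg _ (half_pos hm).le), fun mm t => ?_⟩
    have hbl : BiLoc (fun x z a b => w c μ ((L : ℤ) • y - t) * V c t x z a b) ((N : ℤ) • ((L : ℤ) • y)) ((N : ℤ) • ((L : ℤ) • y))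
        (Cw * Cv * Real.exp (-(δw / 2) * l1 (t - (L : ℤ) • y))) m' := fun x' z' a' b' => abs_dressVTerm_le L hw hCw hδw hV hδ c μ y t x' z' a' b'
    have hdec := KernelPeriodisationFibLoc.decays_dper_diag M hbl (by positivity) hm x (translate M z mm) a b
    have hsc : dper M (fun x z a b => w c μ ((L : ℤ) • y - t) * V c t x z a b) x (translate M z mm) a b
        = w c μ ((L : ℤ) • y - t) * dper M (V c t) x (translate M z mm) a b := by
      simp only [dper_apply, ← tsum_mul_left]
    rw [hsc, l1_sub_symm x (translate M z mm)] at hdec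
    calc |w c μ ((L : ℤ) • y - t) * dper M (V c t) x (translate M z mm) a b|
        ≤ Cw * Cv * Real.exp (-(δw / 2) * l1 (t - (L : ℤ) • y)) * B4Sect5Proof.latticeConst (d + 1) (m' / 2)
            * Real.exp (-(m' / 2) * l1 (translate M z mm - x)) := hdec
      _ = Real.exp (-(m' / 2) * l1 (translate M z mm - x))
            * (Cw * Cv * Real.exp (-(δw / 2) * l1 (t - (L : ℤ) • y)) * B4Sect5Proof.latticeConst (d + 1) (m' / 2)) := by ring
  -- summability in the copy index of the inner source sums (for the finite column sum)
  have hsm : ∀ c : Fin (d + 1), Summable fun mm : Site (d + 1) =>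
      ∑' t : Site (d + 1), w c μ ((L : ℤ) • y - t) * dper M (V c t) x (translate M z mm) a b := by
    intro c
    obtain ⟨h0, h1, -⟩ := (hPB c).summable
    exact (h0.hasSum.prod_fiberwise fun mm => (h1 mm).hasSum).summable
  rw [KernelPeriodisationFib.perZ_apply]
  have step1 : (∑' mm : Site (d + 1), dper M (dressV N L w V μ y) x (translate M z mm) a b)
      = ∑' mm : Site (d + 1), ∑ c : Fin (d + 1), ∑' t : Site (d + 1), w c μ ((L : ℤ) • y - t) * dper M (V c t) x (translate M z mm) a b :=
    tsum_congr fun mm => dper_dressV_apply L M hw hCw hδw hV hδ μ y x _ a b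
  rw [step1, Summable.tsum_finsetSum fun c _ => hsm c]
  refine Finset.sum_congr rfl fun c _ => ?_
  rw [KernelWard.tsum_comm_of_prodBound (hPB c)]
  refine tsum_congr fun t => ?_
  rw [tsum_mul_left, KernelPeriodisationFib.perZ_apply]

/-- [folklore] **`perF_dper_dressV` — ON THE TORUS**: `perF M (dper M (dressV N L w V μ y)) p q = Σ_c Σ'_t w c μ (L•y − t) · perF M (dper M (V c t)) p q`. -/
theorem perF_dper_dressV (hw : ∀ c a u, |w c a u| ≤ Cw * Real.exp (-δw * l1 u)) (hCw : 0 ≤ Cw) (hδw : 0 < δw)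
    (hV : VertexFamily V N Cv δ) (hδ : 0 < δ) (μ : Fin (d + 1)) (y : Site (d + 1)) (p q : Idx M (Fib d)) :
    perF M (dper M (dressV N L w V μ y)) p q
      = ∑ c : Fin (d + 1), ∑' t : Site (d + 1), w c μ ((L : ℤ) • y - t) * perF M (dper M (V c t)) p q := by
  simp only [perF_apply]
  exact perZ_dper_dressV_apply L M hw hCw hδw hV hδ μ y _ _ _ _

end Per

end Summit.QuantumFields.BalabanUV.Beta.FP.KernelStepDressingPeriodised

end
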